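import Summits.NavierStokesRegularity.NavierStokesRegularity.Theses.AxisymmetricExtremality
import Summits.NavierStokesRegularity.NavierStokesRegularity.Theorems.AxisymmetricExtremalityAxisymmetricKatoGlobalStubSereginLogSwirlOriginParabolicNullLines
import Literature.Analysis.FluidPDE.AxisymmetricEuler
import HarnessLib

/-!
# Seregin 2020, proof of Thm 2.1, the no-swirl endgame: a first singular point on the axis with
# a clean parabolic past

Helper toward the stub `stub_seregin2020TypeII` of the crux `AxisymmetricKatoGlobal` (= the named
fact `Literature.Analysis.FluidPDE.Seregin2020_axisymmetricSingularPoint_typeII`, G. Seregin,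
Anal. Math. Phys. 10 (2020) Paper 46 = arXiv:2006.04140, Thm 2.1). The last step of the printed
proof (arXiv p. 8) invokes: "any axially symmetric suitable weak solution with no swirl, i.e.,
`u_φ = 0`, is smooth … (it can be done by considering a problem for `η = ω_φ/ϱ` … and reduction
of it to spatial dimension 5, see, for example, [KangK2004])". The tree renders the `η`-argument
as a LOCAL maximum principle (`Literature.Analysis.FluidPDE.noSwirl_abs_scalar_le_of_boundary`:
a bound for `|η|` on the parabolic boundary of a cylinder `[t₀, t₁] × B̄(c, R)` centred on the
axis, inside which the solution is smooth, propagates inside). To remove the axis singularities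
with it one argues by contradiction from a singular point whose parabolic past is clean: a point
`ẑ = (t̂, ĉ)` of the singular set `S` and a radius `R > 0` such that every point of `S` in the
closed cylinder `[t̂ - R², t̂] × B̄(ĉ, R)` lies at the top time `t̂` and strictly inside, so that
the solution is smooth below `t̂` and near the whole parabolic boundary.

This file proves that such a configuration exists inside any prescribed parabolic neighbourhood
of any point of `S`, for every CLOSED set `S` of points of the axis whose projections to the time
axis and to the symmetry axis are Lebesgue-null (`exists_clean_first_singular_point`) — in
particular for every closed `𝒫¹`-null subset of the axis
(`exists_clean_first_singular_point_of_isParabolicNull`, with the projection lemma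
`volume_image_coord_eq_zero_of_isParabolicNull`; the time projection is the sibling
`volume_image_fst_eq_zero_of_isParabolicNull`). For the singular set of an axisymmetric suitable
weak solution both inputs are in the tree (`singularSet_subset_axis`,
`ckn_partial_regularity_holds`, `isParabolicNull_backwardSingular_top`).

Proof: below the given point `z₀ = (t₀, c₀)` choose a singularity-free time `t_b ∈ ]t₀ - δ², t₀[`
and two singularity-free heights `h₋ ∈ ]c₀₃ - δ, c₀₃ - δ/2[`, `h₊ ∈ ]c₀₃ + δ/2, c₀₃ + δ[` (null
projections); the part `K` of `S` in the compact box `[t_b, t₀] × [h₋, h₊]` (along the axis)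
contains `z₀`, so it has a point `ẑ` of least time `t̂`; necessarily `t̂ > t_b` and
`h₋ < ĉ₃ < h₊` (the faces are singularity free). Any `R > 0` below `ĉ₃ - h₋`, `h₊ - ĉ₃`,
`√(t̂ - t_b)` with `ĉ₃ ± R` outside the (null) height projection works: a point of `S` in
`[t̂ - R², t̂] × {|x₃ - ĉ₃| ≤ R}` lies in `K`, so its time is `≥ t̂`, and its height is not
`ĉ₃ ± R`.

## References

* G. Seregin, Anal. Math. Phys. 10 (2020), Paper 46 = arXiv:2006.04140, proof of Thm. 2.1, last
  paragraph (arXiv p. 8). [Seregin2020]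
* L. Caffarelli, R. Kohn, L. Nirenberg, Comm. Pure Appl. Math. 35 (1982), Theorem B and (2.6)
  (`𝒫¹`-null sets and their covers). [CaffarelliKohnNirenberg1982]
-/

-- the problem directory repeats the summit name (D-0017); core's `dupNamespace` linter fires
set_option linter.dupNamespace false

noncomputable section

open MeasureTheory Set Function Filter Topology TopologicalSpace Metric
open scoped NNReal ENNReal

namespace Summit.NavierStokesRegularity.NavierStokesRegularity.Theorems.AxisymmetricKatoGlobal.EulerScaling

open Literature.Analysis.FluidPDE

/-! ### Null sets on the line -/

/-- An interval of positive length is not covered by a Lebesgue-null set. [folklore] -/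
theorem exists_mem_Ioo_not_mem_of_volume_eq_zero {N : Set ℝ} (hN : volume N = 0) {a b : ℝ}
    (hab : a < b) : ∃ x ∈ Ioo a b, x ∉ N := by
  by_contra hcon
  push Not at hcon
  have hle : volume (Ioo a b) ≤ volume N := measure_mono fun x hx => hcon x hx
  rw [hN, Real.volume_Ioo, nonpos_iff_eq_zero, ENNReal.ofReal_eq_zero] at hle
  linarith

/-- Translates and reflections of a Lebesgue-null set of reals are null:
`{R | c + R ∈ N} ∪ {R | c - R ∈ N}` is null. [folklore] -/
theorem volume_setOf_add_mem_union_sub_mem_eq_zero {N : Set ℝ} (hN : volume N = 0) (c : ℝ) :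
    volume ({R : ℝ | c + R ∈ N} ∪ {R : ℝ | c - R ∈ N}) = 0 := by
  refine measure_union_null ?_ ?_
  · exact measure_preimage_add volume c N ▸ hN ▸ rfl
  · exact (Measure.measurePreserving_sub_left volume c).quasiMeasurePreserving.preimage_null hN

/-! ### The height projection of a `𝒫¹`-null set -/

/-- **The projection of a `𝒫¹`-null set of `ℝ × ℝ³` to a coordinate axis is Lebesgue-null**
(all times together): `volume ((fun z ↦ z.2 i) '' S) = 0` — each centred cylinder `Q*_{rⱼ}(zⱼ)`
of a cheap cover projects into an interval of diameter `≤ 2rⱼ`.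
[cite: CaffarelliKohnNirenberg1982, (2.6)] -/
theorem volume_image_coord_eq_zero_of_isParabolicNull {S : Set (ℝ × EuclideanSpace ℝ (Fin 3))}
    (hS : IsParabolicNull 1 S) (i : Fin 3) :
    volume ((fun z : ℝ × EuclideanSpace ℝ (Fin 3) => z.2 i) '' S) = 0 := by
  refine le_antisymm (ENNReal.le_of_forall_pos_le_add fun ε hε _ => ?_) bot_le
  rw [zero_add]
  have hε2 : (0 : ℝ≥0∞) < (ε : ℝ≥0∞) / 2 := by
    refine ENNReal.div_pos_iff.2 ⟨?_, ENNReal.ofNat_ne_top⟩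
    exact_mod_cast hε.ne'
  obtain ⟨z, r, hr, hcov, hsum⟩ := exists_cover_of_isParabolicNull hS hε2
  set A : ℕ → Set ℝ := fun j =>
    (fun w : ℝ × EuclideanSpace ℝ (Fin 3) => w.2 i) '' parabolicCylinderCentered (r j) (z j) with hA
  have hsub : (fun w : ℝ × EuclideanSpace ℝ (Fin 3) => w.2 i) '' S ⊆ ⋃ j, A j := by
    rintro _ ⟨w, hw, rfl⟩
    obtain ⟨j, hj⟩ := mem_iUnion.1 (hcov hw)
    exact mem_iUnion.2 ⟨j, ⟨w, hj, rfl⟩⟩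
  have hdiam : ∀ j, volume (A j) ≤ 2 * ENNReal.ofReal (r j) := by
    intro j
    rw [← ENNReal.ofReal_ofNat, ← ENNReal.ofReal_mul (by norm_num)]
    refine (Real.volume_le_diam _).trans (Metric.ediam_le ?_)
    rintro _ ⟨w, hw, rfl⟩ _ ⟨w', hw', rfl⟩
    rw [edist_dist, Real.dist_eq]
    refine ENNReal.ofReal_le_ofReal ?_
    have h1 : dist w.2 (z j).2 < r j := (mem_parabolicCylinderCentered.1 hw).2
    have h2 : dist w'.2 (z j).2 < r j := (mem_parabolicCylinderCentered.1 hw').2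
    have h3 : |w.2 i - w'.2 i| ≤ dist w.2 w'.2 := by
      rw [← Real.dist_eq]
      exact PiLp.dist_apply_le w.2 w'.2 i
    have h4 := dist_triangle_right w.2 w'.2 (z j).2
    linarith
  calc volume ((fun w : ℝ × EuclideanSpace ℝ (Fin 3) => w.2 i) '' S)
      ≤ volume (⋃ j, A j) := measure_mono hsub
    _ ≤ ∑' j, volume (A j) := measure_iUnion_le _
    _ ≤ ∑' j, 2 * ENNReal.ofReal (r j) := ENNReal.tsum_le_tsum hdiam
    _ = 2 * ∑' j, ENNReal.ofReal (r j) := ENNReal.tsum_mul_left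
    _ ≤ 2 * ((ε : ℝ≥0∞) / 2) := by gcongr
    _ = ε := by rw [mul_comm, ENNReal.div_mul_cancel two_ne_zero ENNReal.ofNat_ne_top]

/-! ### Points of the axis -/

/-- On the axis the norm is the modulus of the height: `‖x‖ = |x₃|` if `ϱ(x) = 0`. [folklore] -/
theorem norm_eq_abs_of_cylRadius_eq_zero {x : EuclideanSpace ℝ (Fin 3)} (hx : cylRadius x = 0) :
    ‖x‖ = |x 2| := by
  obtain ⟨h0, h1⟩ := (cylRadius_eq_zero_iff x).1 hx
  rw [EuclideanSpace.norm_eq, Fin.sum_univ_three]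
  simp [h0, h1, Real.sqrt_sq_eq_abs]

/-- On the axis distances are differences of heights: `dist x y = |x₃ - y₃|`. [folklore] -/
theorem dist_eq_abs_sub_of_cylRadius_eq_zero {x y : EuclideanSpace ℝ (Fin 3)}
    (hx : cylRadius x = 0) (hy : cylRadius y = 0) : dist x y = |x 2 - y 2| := by
  obtain ⟨hx0, hx1⟩ := (cylRadius_eq_zero_iff x).1 hx
  obtain ⟨hy0, hy1⟩ := (cylRadius_eq_zero_iff y).1 hy
  have hxy : cylRadius (x - y) = 0 :=
    (cylRadius_eq_zero_iff _).2 ⟨by simp [hx0, hy0], by simp [hx1, hy1]⟩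
  rw [dist_eq_norm, norm_eq_abs_of_cylRadius_eq_zero hxy]
  simp

/-! ### The first singular point with a clean past -/

/-- **A singular point of the axis with a clean parabolic past.** Let `S ⊆ ℝ × ℝ³` be closed,
contained in the axis `{ϱ = 0}`, with Lebesgue-null time projection `{t | ∃ x, (t, x) ∈ S}` and
Lebesgue-null height projection `{x₃ | ∃ t x, (t, x) ∈ S, x₃ = x 2}`; let `z₀ = (t₀, c₀) ∈ S` and
`δ > 0`. Then there are `ẑ = (t̂, ĉ) ∈ S` with `t₀ - δ² < t̂ ≤ t₀`, `dist ĉ c₀ < δ`, and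
`0 < R ≤ δ` such that every `z = (t, x) ∈ S` with `dist x ĉ ≤ R` and `t̂ - R² ≤ t ≤ t̂` has
`t = t̂` and `dist x ĉ < R`: below the top time and on the lateral boundary the closed cylinder
`[t̂ - R², t̂] × B̄(ĉ, R)` carries no point of `S` (on the axis `dist x ĉ = |x₃ - ĉ₃|`,
`dist_eq_abs_sub_of_cylRadius_eq_zero`, so the proof runs with heights). This is the
configuration in which the local maximum principle for `η = ω_φ/ϱ` is run when removing axis
singularities of swirl-free solutions.
[cite: Seregin2020, proof of Thm 2.1, last paragraph] -/
theorem exists_clean_first_singular_point :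
    ∀ (S : Set (ℝ × EuclideanSpace ℝ (Fin 3))), IsClosed S →
      (∀ z ∈ S, cylRadius z.2 = 0) →
      volume (Prod.fst '' S) = 0 →
      volume ((fun z : ℝ × EuclideanSpace ℝ (Fin 3) => z.2 2) '' S) = 0 →
      ∀ z₀ ∈ S, ∀ δ : ℝ, 0 < δ →
        ∃ zc ∈ S, ∃ R : ℝ, 0 < R ∧ R ≤ δ ∧ zc.1 ∈ Ioc (z₀.1 - δ ^ 2) z₀.1 ∧
          dist zc.2 z₀.2 < δ ∧
          ∀ z ∈ S, dist z.2 zc.2 ≤ R → zc.1 - R ^ 2 ≤ z.1 → z.1 ≤ zc.1 →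
            z.1 = zc.1 ∧ dist z.2 zc.2 < R := by
  intro S hS haxis hT hN z₀ hz₀ δ hδ
  -- on the axis, distances are differences of heights
  have hdist : ∀ z ∈ S, ∀ z' ∈ S, dist z.2 z'.2 = |z.2 2 - z'.2 2| := fun z hz z' hz' =>
    dist_eq_abs_sub_of_cylRadius_eq_zero (haxis z hz) (haxis z' hz')
  -- ### the singularity-free bottom time and heights
  have hδ2 : 0 < δ ^ 2 := by positivity
  obtain ⟨tb, htb, htbT⟩ := exists_mem_Ioo_not_mem_of_volume_eq_zero hT
    (show z₀.1 - δ ^ 2 < z₀.1 by linarith)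
  obtain ⟨hp, hhp, hhpN⟩ := exists_mem_Ioo_not_mem_of_volume_eq_zero hN
    (show z₀.2 2 + δ / 2 < z₀.2 2 + δ by linarith)
  obtain ⟨hm, hhm, hhmN⟩ := exists_mem_Ioo_not_mem_of_volume_eq_zero hN
    (show z₀.2 2 - δ < z₀.2 2 - δ / 2 by linarith)
  -- membership in the projections
  have hTmem : ∀ z ∈ S, z.1 ∈ Prod.fst '' S := fun z hz => ⟨z, hz, rfl⟩
  have hNmem : ∀ z ∈ S, z.2 2 ∈ (fun z : ℝ × EuclideanSpace ℝ (Fin 3) => z.2 2) '' S :=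
    fun z hz => ⟨z, hz, rfl⟩
  -- ### the compact piece `K` of `S` and its point of least time
  set K : Set (ℝ × EuclideanSpace ℝ (Fin 3)) :=
    S ∩ {z | z.1 ∈ Icc tb z₀.1 ∧ z.2 2 ∈ Icc hm hp} with hK
  have hKclosed : IsClosed K := by
    refine hS.inter (IsClosed.inter ?_ ?_)
    · exact isClosed_Icc.preimage continuous_fst
    · exact isClosed_Icc.preimage ((EuclideanSpace.proj (2 : Fin 3)).continuous.comp continuous_snd)
  have hKsub : K ⊆ Icc tb z₀.1 ×ˢ closedBall (0 : EuclideanSpace ℝ (Fin 3)) (max |hm| |hp|) := by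
    rintro z ⟨hzS, hz1, hz2⟩
    refine ⟨hz1, ?_⟩
    rw [mem_closedBall, dist_zero_right, norm_eq_abs_of_cylRadius_eq_zero (haxis z hzS)]
    exact abs_le_max_abs_abs hz2.1 hz2.2
  have hKc : IsCompact K :=
    (isCompact_Icc.prod (isCompact_closedBall _ _)).of_isClosed_subset hKclosed hKsub
  have hz₀K : z₀ ∈ K :=
    ⟨hz₀, ⟨htb.2.le, le_rfl⟩, ⟨by linarith [hhm.2], by linarith [hhp.1]⟩⟩
  obtain ⟨zh, hzhK, hmin⟩ := hKc.exists_isMinOn ⟨z₀, hz₀K⟩ continuous_fst.continuousOn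
  obtain ⟨hzhS, hzh1, hzh2⟩ := hzhK
  -- `t̂ > t_b` and `h₋ < ĉ₃ < h₊`: the faces of the box are singularity free
  have htb_lt : tb < zh.1 := by
    rcases hzh1.1.eq_or_lt with h | h
    · exact absurd (h ▸ hTmem zh hzhS) htbT
    · exact h
  have hhm_lt : hm < zh.2 2 := by
    rcases hzh2.1.eq_or_lt with h | h
    · exact absurd (h ▸ hNmem zh hzhS) hhmN
    · exact h
  have hhp_gt : zh.2 2 < hp := by
    rcases hzh2.2.eq_or_lt with h | h
    · exact absurd (h ▸ hNmem zh hzhS) hhpN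
    · exact h
  -- ### the radius
  set R₀ : ℝ := min (min (min (hp - zh.2 2) (zh.2 2 - hm)) (Real.sqrt (zh.1 - tb))) δ with hR₀
  have hR₀pos : 0 < R₀ :=
    lt_min (lt_min (lt_min (by linarith) (by linarith)) (Real.sqrt_pos.2 (by linarith))) hδ
  obtain ⟨R, hR, hRgood⟩ := exists_mem_Ioo_not_mem_of_volume_eq_zero
    (volume_setOf_add_mem_union_sub_mem_eq_zero hN (zh.2 2)) hR₀pos
  have hRp : R < hp - zh.2 2 :=
    hR.2.trans_le ((min_le_left _ _).trans ((min_le_left _ _).trans (min_le_left _ _)))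
  have hRm : R < zh.2 2 - hm :=
    hR.2.trans_le ((min_le_left _ _).trans ((min_le_left _ _).trans (min_le_right _ _)))
  have hRt : R ^ 2 < zh.1 - tb := by
    have h1 : R < Real.sqrt (zh.1 - tb) :=
      hR.2.trans_le ((min_le_left _ _).trans (min_le_right _ _))
    have h2 : R ^ 2 < Real.sqrt (zh.1 - tb) ^ 2 := by gcongr; exact hR.1.le
    rwa [Real.sq_sqrt (by linarith)] at h2
  refine ⟨zh, hzhS, R, hR.1, hR.2.le.trans (min_le_right _ _), ⟨htb.1.trans htb_lt, hzh1.2⟩,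
    ?_, fun z hzS hzx hzt1 hzt2 => ?_⟩
  · rw [hdist zh hzhS z₀ hz₀, abs_lt]; constructor <;> linarith [hhm.1, hhp.2]
  rw [hdist z hzS zh hzhS] at hzx ⊢
  -- ### a point of `S` in the closed cylinder lies in `K`, hence at the top time …
  have hzK : z ∈ K := by
    refine ⟨hzS, ⟨by linarith, hzt2.trans hzh1.2⟩, ?_⟩
    rw [abs_le] at hzx
    exact ⟨by linarith [hzx.1], by linarith [hzx.2]⟩
  have hzt : z.1 = zh.1 := le_antisymm hzt2 (hmin hzK)
  -- … and not on the rim: `ĉ₃ ± R` are not heights of points of `S`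
  refine ⟨hzt, lt_of_le_of_ne hzx fun heq => hRgood ?_⟩
  rcases (abs_eq hR.1.le).1 heq with h | h
  · refine Or.inl ?_
    show zh.2 2 + R ∈ (fun z : ℝ × EuclideanSpace ℝ (Fin 3) => z.2 2) '' S
    rw [show zh.2 2 + R = z.2 2 by linarith]
    exact hNmem z hzS
  · refine Or.inr ?_
    show zh.2 2 - R ∈ (fun z : ℝ × EuclideanSpace ℝ (Fin 3) => z.2 2) '' S
    rw [show zh.2 2 - R = z.2 2 by linarith]
    exact hNmem z hzS

/-- **The same for a closed `𝒫¹`-null subset of the axis** (the singular set of an axisymmetric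
suitable weak solution in a compact region: `singularSet_subset_axis`,
`ckn_partial_regularity_holds`, `isParabolicNull_backwardSingular_top`): both projections of a
`𝒫¹`-null set are Lebesgue-null (`volume_image_fst_eq_zero_of_isParabolicNull`,
`volume_image_coord_eq_zero_of_isParabolicNull`).
[cite: Seregin2020, proof of Thm 2.1, last paragraph] -/
theorem exists_clean_first_singular_point_of_isParabolicNull :
    ∀ (S : Set (ℝ × EuclideanSpace ℝ (Fin 3))), IsClosed S →
      (∀ z ∈ S, cylRadius z.2 = 0) → IsParabolicNull 1 S →
      ∀ z₀ ∈ S, ∀ δ : ℝ, 0 < δ →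
        ∃ zc ∈ S, ∃ R : ℝ, 0 < R ∧ R ≤ δ ∧ zc.1 ∈ Ioc (z₀.1 - δ ^ 2) z₀.1 ∧
          dist zc.2 z₀.2 < δ ∧
          ∀ z ∈ S, dist z.2 zc.2 ≤ R → zc.1 - R ^ 2 ≤ z.1 → z.1 ≤ zc.1 →
            z.1 = zc.1 ∧ dist z.2 zc.2 < R :=
  fun S hS haxis hP z₀ hz₀ δ hδ =>
    exists_clean_first_singular_point S hS haxis (volume_image_fst_eq_zero_of_isParabolicNull hP)
      (volume_image_coord_eq_zero_of_isParabolicNull hP 2) z₀ hz₀ δ hδ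

end Summit.NavierStokesRegularity.NavierStokesRegularity.Theorems.AxisymmetricKatoGlobal.EulerScaling

end
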